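import Mathlib.LinearAlgebra.Span.Basic
import Mathlib.Algebra.BigOperators.Group.Finset.Basic
import HarnessLib

/-!
# The rigorous direction of the generic-letter probe (w1-cx-2 gen 13, code B)

Kernel leg of `widen/W1/OFFLINE-ETA-w1cx2.md` §2 (cell pub-hsemireg, W1 «objects beyond sheaves»,
model-level): the transferred product `m_N` of the census model is MULTILINEAR in its `N`
letters, so its value on letters that are linear combinations `Σ_r c_r · rep_r` of basis
representatives is the corresponding linear combination of its values on basis choices.  The
probe evaluates ONE such combination (random integer coefficients) and reads two things off it:

* if the combined value is non-zero, SOME basis choice has a non-zero value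
  (`exists_ne_zero_of_sum_smul_ne_zero`);
* if the combined value lies outside a submodule `W` (in the note: `W = V* = η_{Γ′₁} ⊗ H¹`),
  SOME basis choice has its value outside `W` (`exists_not_mem_of_sum_smul_not_mem`),

both with no assumption on the coefficients — the converse directions («zero ∕ inside for one
draw ⇒ for all choices») are only probabilistic and are NOT claimed.  The statements are the
elementary contrapositives of `Submodule.sum_mem` ∕ `Finset.sum_eq_zero`; they are recorded here
because a result of record of the cell («(T-ii) is false at N = 16», HOME/INBOX l.23232) rests on
exactly this inference.  Nothing here says HC, HC_CM or HC_AV is proved.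
-/

namespace Summit.Ventures.HSemireg.GenericLetterProbe

open BigOperators

variable {K V ι : Type*} [Ring K] [AddCommGroup V] [Module K V]

/-- If a finite linear combination `∑ i in s, c i • v i` does not lie in the submodule `W`, then
some `v i` with `i ∈ s` does not lie in `W` (contrapositive of `Submodule.sum_mem` with
`Submodule.smul_mem`).  This is the inference «generic draw outside V* ⇒ some basis word outside
V*» of the generic-letter probe. -/
theorem exists_not_mem_of_sum_smul_not_mem (W : Submodule K V) (s : Finset ι) (c : ι → K)
    (v : ι → V) (h : (∑ i ∈ s, c i • v i) ∉ W) : ∃ i ∈ s, v i ∉ W := by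
  by_contra hcon
  push Not at hcon
  exact h (W.sum_mem fun i hi => W.smul_mem (c i) (hcon i hi))

/-- If a finite linear combination `∑ i in s, c i • v i` is non-zero, then some `v i` with
`i ∈ s` is non-zero.  This is the inference «generic draw non-zero ⇒ some basis word NONZERO». -/
theorem exists_ne_zero_of_sum_smul_ne_zero (s : Finset ι) (c : ι → K) (v : ι → V)
    (h : (∑ i ∈ s, c i • v i) ≠ 0) : ∃ i ∈ s, v i ≠ 0 := by
  by_contra hcon
  push Not at hcon
  exact h (Finset.sum_eq_zero fun i hi => by rw [hcon i hi, smul_zero])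

/-- The same two facts for a value depending on several independent letters at once: a family
of vectors indexed by the (finite) set of basis CHOICES `ι` (one index per tuple of basis indices),
weighted by arbitrary coefficients (in the probe: the products of the per-letter coefficients).
If the weighted sum is outside `W`, some choice is outside `W`; stated over `Finset.univ` of a
`Fintype` of choices. -/
theorem exists_choice_not_mem [Fintype ι] (W : Submodule K V) (c : ι → K) (v : ι → V)
    (h : (∑ i, c i • v i) ∉ W) : ∃ i, v i ∉ W := by
  obtain ⟨i, -, hi⟩ := exists_not_mem_of_sum_smul_not_mem W Finset.univ c v h
  exact ⟨i, hi⟩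

/-- Conversely (the direction the probe does NOT use as a proof): if every `v i` lies in `W`
then every weighted sum does — so a draw landing inside `W` is CONSISTENT with, but does not
prove, «all choices inside W». -/
theorem sum_smul_mem_of_forall_mem (W : Submodule K V) (s : Finset ι) (c : ι → K) (v : ι → V)
    (h : ∀ i ∈ s, v i ∈ W) : (∑ i ∈ s, c i • v i) ∈ W :=
  W.sum_mem fun i hi => W.smul_mem (c i) (h i hi)

end Summit.Ventures.HSemireg.GenericLetterProbe
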